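import Summits.PneNP.PneNP.Theorems.BruckRyserSosSosBlindPlanesRelabel

/-!
# PneNP / BruckRyserSos — moment tables, template moments and the invariant moment matrix

Route `PneNP/BruckRyserSos`, crux stmt-PneNP-16761 (`SosBlindPlanes`), second file.

The degree-`d` pseudo-moments of an `S_v × S_v`-invariant functional on the `v × v` board are
determined by finitely many numbers INDEPENDENTLY of `v`: a TABLE `μ : Finset (Fin D × Fin D) → ℝ`
on the template grid (`D = d + 1` later). This file builds, from a table,

* `canon D U` — a template relabeling of a board configuration `U` with at most `D` points and
  `D` lines (ANY relabeling injective on its points and lines; all of them agree up to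
  `S_D × S_D`, `Relabel.exists_perm_rel_eq`), and the TEMPLATE MOMENT `tmom D μ U := μ (canon D U)`;
* `TabInv μ` — invariance of the table under `S_D × S_D`; then `tmom` is invariant under every
  relabeling injective on points and lines (`tmom_rel`), in particular under `S_v × S_v` and under
  the grid embeddings `Fin N ↪ Fin v`, and restricts to `μ` on templates (`tmom_emb_template`);
* `momMatrix D h μ` — the moment matrix `(S, T) ↦ tmom D μ (S ∪ T)` on configurations with at most
  `h` cells, symmetric and `S_v × S_v`-invariant;
* (file `…Grid`) the template grid inside a board, and the split / transport lemmas behind the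
  reduction of the design identities to finitely many template identities (file `…Identities`).

References: Kothari–Mori–O'Donnell–Witmer (STOC 2017) Defs. 2.7–2.8 (pseudo-moments); M. Laurent,
Math. Oper. Res. 28 (2003) (moment matrices, symmetry); folklore.
-/

set_option linter.dupNamespace false -- `Summit.PneNP.PneNP.…`: summit = sub-problem name (D-0017 single-conjunct layout)

noncomputable section

namespace Summit.PneNP.PneNP.Theorems.SosBlindPlanes

open Finset Function

variable {v v' D : ℕ}

/-! ### Template relabelings and template moments -/

/-- If a configuration has at most `D` points (`0 < D`), some point map into the template grid is
injective on them. [folklore] -/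
theorem exists_injOn_fin (hD : 0 < D) (s : Finset (Fin v)) (hs : s.card ≤ D) :
    ∃ f : Fin v → Fin D, Set.InjOn f s :=
  haveI : Nonempty (Fin D) := ⟨⟨0, hD⟩⟩
  exists_injOn_of_card_le s (by simpa using hs)

/-- A TEMPLATE RELABELING of a board configuration with at most `D` points and at most `D` lines:
its image under some relabeling into `Fin D × Fin D` injective on its points and on its lines
(`∅` if the configuration does not fit). [folklore] -/
def canon (D : ℕ) (U : Finset (Fin v × Fin v)) : Finset (Fin D × Fin D) :=
  if h : 0 < D ∧ (pts U).card ≤ D ∧ (lns U).card ≤ D then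
    rel (Classical.choose (exists_injOn_fin h.1 (pts U) h.2.1))
      (Classical.choose (exists_injOn_fin h.1 (lns U) h.2.2)) U
  else ∅

/-- The template relabeling is a relabeling injective on points and on lines. [folklore] -/
theorem canon_spec (hD : 0 < D) {U : Finset (Fin v × Fin v)} (hP : (pts U).card ≤ D)
    (hL : (lns U).card ≤ D) :
    ∃ (f g : Fin v → Fin D), Set.InjOn f (pts U) ∧ Set.InjOn g (lns U) ∧ canon D U = rel f g U := by
  have h : 0 < D ∧ (pts U).card ≤ D ∧ (lns U).card ≤ D := ⟨hD, hP, hL⟩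
  refine ⟨_, _, Classical.choose_spec (exists_injOn_fin h.1 (pts U) h.2.1),
    Classical.choose_spec (exists_injOn_fin h.1 (lns U) h.2.2), ?_⟩
  simp only [canon, h, and_self, dite_true]

/-- Invariance of a table under the template symmetry group `S_D × S_D`. [folklore] -/
def TabInv (μ : Finset (Fin D × Fin D) → ℝ) : Prop :=
  ∀ (σ τ : Equiv.Perm (Fin D)) (W : Finset (Fin D × Fin D)), μ (rel σ τ W) = μ W

/-- For an invariant table, EVERY relabeling of `U` injective on its points and lines gives the
value of the template relabeling. [folklore] -/
theorem apply_canon_eq {μ : Finset (Fin D × Fin D) → ℝ} (hμ : TabInv μ) (hD : 0 < D)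
    {U : Finset (Fin v × Fin v)} {f g : Fin v → Fin D} (hf : Set.InjOn f (pts U))
    (hg : Set.InjOn g (lns U)) : μ (canon D U) = μ (rel f g U) := by
  have hP : (pts U).card ≤ D := by
    simpa using Finset.card_le_card_of_injOn f (fun _ _ => mem_univ _) hf
  have hL : (lns U).card ≤ D := by
    simpa using Finset.card_le_card_of_injOn g (fun _ _ => mem_univ _) hg
  obtain ⟨f₀, g₀, hf₀, hg₀, hc⟩ := canon_spec hD hP hL
  obtain ⟨σ, τ, hστ⟩ := exists_perm_rel_eq U hf₀ hf hg₀ hg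
  rw [hc, ← hστ, hμ]

/-- The TEMPLATE MOMENT of a board configuration: the table value of its template relabeling
(`0` if it has more than `D` points or lines). [folklore] -/
def tmom (D : ℕ) (μ : Finset (Fin D × Fin D) → ℝ) (U : Finset (Fin v × Fin v)) : ℝ :=
  if (pts U).card ≤ D ∧ (lns U).card ≤ D then μ (canon D U) else 0

/-- The template moment of a configuration that fits the template grid. [folklore] -/
theorem tmom_of_le {μ : Finset (Fin D × Fin D) → ℝ} {U : Finset (Fin v × Fin v)}
    (hP : (pts U).card ≤ D) (hL : (lns U).card ≤ D) : tmom D μ U = μ (canon D U) := by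
  simp [tmom, hP, hL]

/-- The template moment of a configuration with at most `D` cells. [folklore] -/
theorem tmom_of_card_le {μ : Finset (Fin D × Fin D) → ℝ} {U : Finset (Fin v × Fin v)}
    (h : U.card ≤ D) : tmom D μ U = μ (canon D U) :=
  tmom_of_le ((card_pts_le U).trans h) ((card_lns_le U).trans h)

/-- **Template moments are invariant under relabelings injective on points and lines** (between
any two boards). [folklore] -/
theorem tmom_rel {μ : Finset (Fin D × Fin D) → ℝ} (hμ : TabInv μ) (hD : 0 < D)
    {U : Finset (Fin v × Fin v)} {f g : Fin v → Fin v'} (hf : Set.InjOn f (pts U))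
    (hg : Set.InjOn g (lns U)) : tmom D μ (rel f g U) = tmom D μ U := by
  unfold tmom
  rw [card_pts_rel g hf, card_lns_rel f hg]
  split_ifs with h
  · obtain ⟨f₁, g₁, hf₁, hg₁, hc⟩ := canon_spec hD (U := rel f g U)
      (by rw [card_pts_rel g hf]; exact h.1) (by rw [card_lns_rel f hg]; exact h.2)
    rw [hc, rel_rel]
    symm
    apply apply_canon_eq hμ hD
    · intro x hx y hy hxy
      exact hf hx hy (hf₁ (by rw [pts_rel]; exact mem_image_of_mem _ hx)
        (by rw [pts_rel]; exact mem_image_of_mem _ hy) hxy)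
    · intro x hx y hy hxy
      exact hg hx hy (hg₁ (by rw [lns_rel]; exact mem_image_of_mem _ hx)
        (by rw [lns_rel]; exact mem_image_of_mem _ hy) hxy)
  · rfl

/-- Invariance under the board symmetry group `S_v × S_v`. [folklore] -/
theorem tmom_rel_perm {μ : Finset (Fin D × Fin D) → ℝ} (hμ : TabInv μ) (hD : 0 < D)
    (σ τ : Equiv.Perm (Fin v)) (U : Finset (Fin v × Fin v)) :
    tmom D μ (rel σ τ U) = tmom D μ U :=
  tmom_rel hμ hD (σ.injective.injOn) (τ.injective.injOn)

/-- On a template (a configuration of the template board itself) the template moment is the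
table value. [folklore] -/
theorem tmom_template {μ : Finset (Fin D × Fin D) → ℝ} (hμ : TabInv μ) (hD : 0 < D)
    (W : Finset (Fin D × Fin D)) : tmom D μ W = μ W := by
  rw [tmom_of_le (by simpa using card_le_univ (pts W)) (by simpa using card_le_univ (lns W)),
    apply_canon_eq hμ hD (Set.injOn_id _) (Set.injOn_id _), rel_id]

/-- A template embedded into any board (injectively on its points and lines) has template moment
its table value. [folklore] -/
theorem tmom_rel_template {μ : Finset (Fin D × Fin D) → ℝ} (hμ : TabInv μ) (hD : 0 < D)
    (W : Finset (Fin D × Fin D)) {f g : Fin D → Fin v} (hf : Set.InjOn f (pts W))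
    (hg : Set.InjOn g (lns W)) : tmom D μ (rel f g W) = μ W := by
  rw [tmom_rel hμ hD hf hg, tmom_template hμ hD]

/-! ### The invariant moment matrix -/

/-- Index set of the degree-`h` moment matrix: board configurations with at most `h` cells.
[folklore] -/
abbrev Idx (v h : ℕ) : Type := {S : Finset (Fin v × Fin v) // S.card ≤ h}

/-- The action of the board symmetry group on the index set. [folklore] -/
def act {h : ℕ} (σ τ : Equiv.Perm (Fin v)) (S : Idx v h) : Idx v h :=
  ⟨rel σ τ S.1, by rw [card_rel σ.injective.injOn τ.injective.injOn]; exact S.2⟩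

/-- The underlying configuration of the image under the action. [folklore] -/
@[simp] theorem act_val {h : ℕ} (σ τ : Equiv.Perm (Fin v)) (S : Idx v h) :
    (act σ τ S).1 = rel σ τ S.1 := rfl

/-- The action is multiplicative. [folklore] -/
theorem act_act {h : ℕ} (σ τ σ' τ' : Equiv.Perm (Fin v)) (S : Idx v h) :
    act σ' τ' (act σ τ S) = act (σ' * σ) (τ' * τ) S := by
  apply Subtype.ext
  simp only [act_val, rel_rel, Equiv.Perm.coe_mul]

/-- The identity acts trivially. [folklore] -/
@[simp] theorem act_one {h : ℕ} (S : Idx v h) : act (1 : Equiv.Perm (Fin v)) 1 S = S := by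
  apply Subtype.ext
  simp only [act_val, Equiv.Perm.coe_one, rel_id]

/-- The action by a pair of permutations is a permutation of the index set. [folklore] -/
def actEquiv {h : ℕ} (σ τ : Equiv.Perm (Fin v)) : Idx v h ≃ Idx v h where
  toFun := act σ τ
  invFun := act σ⁻¹ τ⁻¹
  left_inv S := by rw [act_act]; simp
  right_inv S := by rw [act_act]; simp

/-- `actEquiv` is `act`. [folklore] -/
@[simp] theorem actEquiv_apply {h : ℕ} (σ τ : Equiv.Perm (Fin v)) (S : Idx v h) :
    actEquiv σ τ S = act σ τ S := rfl

/-- The degree-`h` MOMENT MATRIX of a table on the `v × v` board: `(S, T) ↦ tmom (S ∪ T)`.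
[Laurent 2003, §2 (moment matrices)] [folklore] -/
def momMatrix (v D h : ℕ) (μ : Finset (Fin D × Fin D) → ℝ) : Matrix (Idx v h) (Idx v h) ℝ :=
  fun S T => tmom D μ (S.1 ∪ T.1)

/-- Entries of the moment matrix. [folklore] -/
theorem momMatrix_apply {h : ℕ} (μ : Finset (Fin D × Fin D) → ℝ) (S T : Idx v h) :
    momMatrix v D h μ S T = tmom D μ (S.1 ∪ T.1) := rfl

/-- The moment matrix is symmetric. [folklore] -/
theorem momMatrix_symm {h : ℕ} (μ : Finset (Fin D × Fin D) → ℝ) (S T : Idx v h) :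
    momMatrix v D h μ S T = momMatrix v D h μ T S := by
  rw [momMatrix_apply, momMatrix_apply, union_comm]

/-- The moment matrix is symmetric (Hermitian over `ℝ`). [folklore] -/
theorem momMatrix_isHermitian {h : ℕ} (μ : Finset (Fin D × Fin D) → ℝ) :
    (momMatrix v D h μ).IsHermitian := by
  apply Matrix.IsHermitian.ext
  intro S T
  rw [star_trivial, momMatrix_symm]

/-- The moment matrix of an invariant table is invariant under the board symmetry group.
[folklore] -/
theorem momMatrix_act {h : ℕ} {μ : Finset (Fin D × Fin D) → ℝ} (hμ : TabInv μ) (hD : 0 < D)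
    (σ τ : Equiv.Perm (Fin v)) (S T : Idx v h) :
    momMatrix v D h μ (act σ τ S) (act σ τ T) = momMatrix v D h μ S T := by
  simp only [momMatrix_apply, act_val, ← rel_union]
  exact tmom_rel_perm hμ hD σ τ _

end Summit.PneNP.PneNP.Theorems.SosBlindPlanes
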